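import Summits.BirchSwinnertonDyer.BirchSwinnertonDyer.Theses.SemiOrdinaryEisensteinDescent
import Summits.BirchSwinnertonDyer.BirchSwinnertonDyer.Theorems.SemiOrdinaryEisensteinDescentEisensteinKernelAtThreeOfValueAtOneV
import HarnessLib

/-!
# Route `SemiOrdinaryEisensteinDescent`, support item `EisensteinKernelAtThreeMultiCarrierOddOfValueAtOneV`
# (stmt-BirchSwinnertonDyer-26611, act G′-V kernel): published inputs → the minimal Eisenstein currency `E_𝟙^V` →
# Kolyvagin primitives (print) → Jetchev max-form mod 3 → `J‴` σ-divisibility on multi-carrier frames → Hsieh ∧ BDP ∧ LZZ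
# print → Poitou–Tate duality → rank-zero twist ⟹ the rung `WAllExclAddWildRankOneSurj`, PROVED (pure assembly)

Cell `bsd-wall` (W-ALL, row 2·3@3 lane 3), width seat `bsd-wall-soed-p1-w2` (gen 12), 2026-08-28, on the route pen's act G′-V
(planner bsd-wall-pss3x g3): `closes (hIn hE1V hPr hPTc hGJ hJ hW hZ hK) := hK hIn hE1V hPr (hGJ hPTc) hJ hW (PT4 of the conj PT) hZ`
with `hK : EisensteinKernelAtThreeMultiCarrierOddOfValueAtOneV` — crux #2 is now the VALUE-AT-𝟙 SHADOW `E_𝟙^V`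
(`WildSplitEisensteinValueAtOneV`: odd `d_K`, at a displayed unit value) in place of the Λ-adic `E′` (24155, aside), and the
act-G kernel‴′ (25899) is superseded. The theorem below has LITERALLY the type
`Summit.BirchSwinnertonDyer.BirchSwinnertonDyer.Theses.SemiOrdinaryEisensteinDescent.EisensteinKernelAtThreeMultiCarrierOddOfValueAtOneV`.

PROOF = the item's recipe: this seat's landed
`EisensteinKernelAtThreeOfValueAtOneV.wAllExclAddWildRankOneSurj_of_valueAtOneV_of_sigmaMultiCarrier_of_jetchevMaxModThree_of_primitives_of_poitouTate`
(p609065 §3: the three McCallum-road primitives + Jetchev max-form mod 3 + `J‴` give the tower-free Kolyvagin upper bound via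
soed-p2's p598295; then kernel⁗ re-run on `E_𝟙^V` — p606694 §1 with the Eisenstein step fed `hodd`, `u`, `hval` — with the
odd-`d_K` frame 24475 discharged by name), applied to the route's binders, which unfold to its displayed hypotheses.

HONEST FRAMING: this closes a SUPPORT item (pure assembly); every research binder of the deciding chain — `E_𝟙^V` (the «≥»
half of the 3-part of #Ш(E/K) at Friedberg–Hoffstein data on the onto wild r₁ cell, read at a unit value display; no engine in
print: walls W1–W3 of `Cruxes/WildSplitEisensteinInclusionAtThree/Lines/birth-dead*.md`), `J‴` (σ-divisibility of Kolyvagin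
classes on multi-carrier frames at the additive prime 3), the Jetchev max-form item and the rank-zero twist leaf `Z` (20387) — is
an ANTECEDENT of the statement proved, as are the printed packages. BSD is not proved for any curve by this file. No definition,
no named fact, no `sorry`.

References: [JetchevSkinnerWan2017] Thm. 3.3.1, §7.4.1 (arXiv:1512.06894 pp. 11, 30); [LiuZhangZhang2018] Thm 1.5.1/1.5.3;
[MilneADT2006] I Thm. 4.10(b); [GrossZagier1986] I.(6.3), V §2; [FriedbergHoffstein1995] Thm. B; [McCallumLMS1991] §3;
[GrossLMS1991] Prop. 3.7(2), §6; [Kolyvagin1990] Thm. A; [Jetchev2008] Thm. 1.4; [Hsieh2014] Thm. A;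
[BertoliniDarmonPrasanna2013] Thm. 5.13.
-/

noncomputable section

open scoped Classical NumberField

set_option linter.dupNamespace false -- `Summit.BirchSwinnertonDyer.BirchSwinnertonDyer.Theorems.…` (summit = sub, D-0017)
set_option autoImplicit false

namespace Summit.BirchSwinnertonDyer.BirchSwinnertonDyer.Theorems

open Summit.BirchSwinnertonDyer.BirchSwinnertonDyer.Theses.SemiOrdinaryEisensteinDescent

/-- **Item `EisensteinKernelAtThreeMultiCarrierOddOfValueAtOneV` (stmt-BirchSwinnertonDyer-26611) of route
`SemiOrdinaryEisensteinDescent` holds**: `PublishedInputsWildThree → WildSplitEisensteinValueAtOneV → KolyvaginPrimitivesAtThree →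
JetchevMaxDivisibilityAtThreeModThree → WildSigmaDivisibilityAtThreeMultiCarrier → WildSplitPrintedInputsAtThree →
PoitouTateSelmerStructureDualityFact → WildRankZeroTwistAtThree ⟹ WAllExclAddWildRankOneSurj` — Jetchev–Skinner–Wan's §7.4
assembly at the wild split `3` in the minimal Eisenstein currency: primitives + Jetchev max-form + `J‴` ⟹ tower-free Kolyvagin
upper bound (p598295); with `E_𝟙^V`, the printed package, Poitou–Tate duality and the rank-zero twist leaf ⟹ the rung
(p609065 §3 over kernel⁗ p606694). Every crux / fact is an antecedent; BSD is not proved by this.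
[cite: JetchevSkinnerWan2017, Thm. 3.3.1 and §7.4.1 (arXiv:1512.06894 pp. 11, 30)] [cite: McCallumLMS1991, §3]
[cite: GrossLMS1991, Prop. 3.7(2) and §6] [cite: MilneADT2006, Ch. I, Thm. 4.10(b)] -/
theorem semiOrdinaryEisensteinDescent_eisensteinKernelAtThreeMultiCarrierOddOfValueAtOneV_proof :
    EisensteinKernelAtThreeMultiCarrierOddOfValueAtOneV := by
  unfold EisensteinKernelAtThreeMultiCarrierOddOfValueAtOneV
  intro hIn hE1V hPr hJmax hJ hW hPT hZ
  exact EisensteinKernelAtThreeOfValueAtOneV.wAllExclAddWildRankOneSurj_of_valueAtOneV_of_sigmaMultiCarrier_of_jetchevMaxModThree_of_primitives_of_poitouTate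
    hIn hE1V hPr hJmax hJ hW hPT hZ

end Summit.BirchSwinnertonDyer.BirchSwinnertonDyer.Theorems

end
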